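import Summits.ResolutionOfSingularities.ResolutionOfSingularities.Theorems.PAlterationPialtTamePatching
import Summits.ResolutionOfSingularities.ResolutionOfSingularities.Theorems.PAlterationPialtTameDefs
import Literature.AlgebraicGeometry.Resolution.ProperModelsModification
import Literature.AlgebraicGeometry.Resolution.ProperModelsJoin
import HarnessLib

/-!
# `Pialt` (crux stmt-ResolutionOfSingularities-0555), line `SketchIdeator2` / Card A: exactness of the kernel

Helper file for the OPEN stub `stub_tameResolution` (`TameResolution_p`) of the lead's skeleton
`radicially-regular-endgame` (`--supports stmt-ResolutionOfSingularities-0555`; it does not close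
the item). Steps V10 and K1 of `Cruxes/Pialt/STUB-PLAN-stub_tameResolution.md`.

Vocabulary (INLINED): RR / LRR / tame as in `PAlterationPialtTameTransfer.lean`; the **kernel**
("two-model tame patching", Piltant 2013, Prop. 5.1 with `P = P_LRR`) as in
`PAlterationPialtTamePatching.lean`: any two proper models `M₁, M₂` of `K/k` are dominated by a
third through morphisms `φᵢ` with `φᵢ⁻¹(LRR Mᵢ) ⊆ LRR N`.

* `twoModelTamePatchingAt_of_tame` (V10) — **tame resolution over `k` implies the kernel over
  `k`**: tame-resolve the join `J(M₁, M₂)` (`ProperModel.join`) by `ρ : Z → J`; the modification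
  model `N := (Z, ρ ≫ π_J)` (`ProperModel.ofModification`) dominates both `Mᵢ`, and since `Z` is
  LRR everywhere the monotonicity conditions hold trivially.
* `twoModelTamePatching_of_tame` — the same quantified over all perfect fields of
  characteristic `p`: the STUB implies the KERNEL.
* `tame_iff_twoModelTamePatching_of_temkin2013` — **exactness**: under `Temkin2013`,
  `TameResolution_p ↔` kernel at `p` (with `stub_tameResolution_of_temkin2013_of_twoModelTamePatching`).
  So registering the kernel as the residual stub loses nothing.
* `twoModelTamePatching_of_resolutionInChar` (K1) — resolution of singularities in
  characteristic `p` implies the kernel (through `tameResolution_of_resolutionInChar`): the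
  kernel is known wherever resolution is (e.g. `trdeg ≤ 3` via Cossart–Piltant at the level of
  `ResolutionOverUpToDim`), and is not stronger than the summit.
* `tame_of_twoModelTamePatchingAt_of_temkin2013`, `tame_iff_twoModelTamePatchingAt_of_temkin2013`
  — **the cut is field-wise and needs no perfectness**: for ANY field `k` of characteristic `p`,
  under `Temkin2013`, (every integral separated f.t. `k`-scheme is tame) ↔ (two-model tame
  patching for proper models over `k`). Perfectness of `k` enters the line only through T4/T5
  (Frobenius domination), not through the valuative reduction.
* By name, in the vocabulary of `PAlterationPialtTameDefs.lean` (`TameResolutionInChar p` = the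
  stub at `p`, `TwoModelTamePatching p` = the kernel), for the lead's RESHAPE of the skeleton:
  `stub_tameResolution_of_temkin2013_of_kernel` (**the registered stub verbatim from
  `Temkin2013` and `TwoModelTamePatching p`**), `tameResolutionInChar_of_temkin2013_of_twoModelTamePatching`,
  `twoModelTamePatching_of_tameResolutionInChar`, `tameResolutionInChar_iff_twoModelTamePatching`
  (`Temkin2013 → (TameResolutionInChar p ↔ TwoModelTamePatching p)`),
  `twoModelTamePatching_of_resolutionInChar'`.
-/

set_option linter.dupNamespace false -- mandated namespace of this single-conjunct summit

noncomputable section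

open CategoryTheory AlgebraicGeometry TopologicalSpace
open Literature.AlgebraicGeometry Literature.AlgebraicGeometry.Resolution

namespace Summit.ResolutionOfSingularities.ResolutionOfSingularities.Theorems.Pialt.RadiciallyRegular

/-! ## Tame resolution implies two-model tame patching (V10) -/

/-- **Tame resolution over `k` implies two-model tame patching over `k`.** If every integral
separated `k`-scheme of finite type has a tame resolution, then any two proper models `M₁, M₂`
of a field `K/k` are dominated by a proper model `N` through morphisms `φᵢ` such that every
point of `N` over an RR open of `Mᵢ` has an RR open neighbourhood: tame-resolve the join
`J(M₁, M₂)` by `ρ : Z → J` and take the modification model `N = (Z, ρ ≫ π_J)`; ALL points of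
`N.X = Z` have RR neighbourhoods. [cite: Piltant2013, Prop. 5.1 (proof, Step 2); ZariskiSamuel1960, Ch. VI §17] -/
theorem twoModelTamePatchingAt_of_tame {k : Type} [Field k]
    (h : ∀ (X : Scheme.{0}) (f : X ⟶ Spec (.of k)), IsSeparated f → LocallyOfFiniteType f →
      QuasiCompact f → IsIntegral X →
        ∃ (Z : Scheme.{0}) (π : Z ⟶ X), IsProper π ∧ IsBirational π ∧ IsIntegral Z ∧
          (∀ z : Z, IsIntegrallyClosed (Z.presheaf.stalk z)) ∧
          ∀ z : Z, ∃ U : Z.Opens, z ∈ U ∧ ∃ (W : Scheme.{0}) (h : W ⟶ (U : Scheme.{0})),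
            IsIntegral W ∧ Scheme.IsRegular W ∧ IsFinite h ∧ UniversallyInjective h ∧
              Function.Surjective h.base)
    (K : Type) [Field K] [Algebra k K] (M₁ M₂ : ProperModel k K) :
    ∃ (N : ProperModel k K) (φ₁ : N.Hom M₁) (φ₂ : N.Hom M₂),
      (∀ y : N.X, (∃ U : M₁.X.Opens, φ₁.f.base y ∈ U ∧
        ∃ (W : Scheme.{0}) (h : W ⟶ (U : Scheme.{0})), IsIntegral W ∧ Scheme.IsRegular W ∧
          IsFinite h ∧ UniversallyInjective h ∧ Function.Surjective h.base) →
        ∃ V : N.X.Opens, y ∈ V ∧ ∃ (W : Scheme.{0}) (h : W ⟶ (V : Scheme.{0})),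
          IsIntegral W ∧ Scheme.IsRegular W ∧ IsFinite h ∧ UniversallyInjective h ∧
            Function.Surjective h.base) ∧
      (∀ y : N.X, (∃ U : M₂.X.Opens, φ₂.f.base y ∈ U ∧
        ∃ (W : Scheme.{0}) (h : W ⟶ (U : Scheme.{0})), IsIntegral W ∧ Scheme.IsRegular W ∧
          IsFinite h ∧ UniversallyInjective h ∧ Function.Surjective h.base) →
        ∃ V : N.X.Opens, y ∈ V ∧ ∃ (W : Scheme.{0}) (h : W ⟶ (V : Scheme.{0})),
          IsIntegral W ∧ Scheme.IsRegular W ∧ IsFinite h ∧ UniversallyInjective h ∧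
            Function.Surjective h.base) := by
  let J : ProperModel k K := ProperModel.join M₁ M₂
  -- tame-resolve the join
  obtain ⟨Z, ρ, hρ, hbir, hZ, -, hL⟩ :=
    h J.X J.π inferInstance inferInstance inferInstance inferInstance
  haveI := hρ
  haveI := hZ
  obtain ⟨U, hU, hiso⟩ := J.exists_nonempty_isIso_morphismRestrict hbir
  haveI := hiso
  -- the modification model `N = (Z, ρ ≫ π_J)` dominates `J`, hence `M₁` and `M₂`
  refine ⟨ProperModel.ofModification J ρ U hU,
    (ProperModel.ofModificationHom J ρ U hU).comp (ProperModel.joinFst M₁ M₂),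
    (ProperModel.ofModificationHom J ρ U hU).comp (ProperModel.joinSnd M₁ M₂),
    fun y _ => hL y, fun y _ => hL y⟩

/-- **The stub implies the kernel**: tame resolution over all perfect fields of characteristic
`p` (the statement of `stub_tameResolution` at `p`) implies two-model tame patching over all
perfect fields of characteristic `p` (the hypothesis `hZ` of
`stub_tameResolution_of_temkin2013_of_twoModelTamePatching`). [cite: Piltant2013, Prop. 5.1] -/
theorem twoModelTamePatching_of_tame (p : ℕ)
    (h : ∀ (k : Type) [Field k] [CharP k p] [PerfectField k] (X : Scheme.{0})
      (f : X ⟶ Spec (.of k)), IsSeparated f → LocallyOfFiniteType f → QuasiCompact f →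
        IsIntegral X →
          ∃ (Z : Scheme.{0}) (π : Z ⟶ X), IsProper π ∧ IsBirational π ∧ IsIntegral Z ∧
            (∀ z : Z, IsIntegrallyClosed (Z.presheaf.stalk z)) ∧
            ∀ z : Z, ∃ U : Z.Opens, z ∈ U ∧ ∃ (W : Scheme.{0}) (h : W ⟶ (U : Scheme.{0})),
              IsIntegral W ∧ Scheme.IsRegular W ∧ IsFinite h ∧ UniversallyInjective h ∧
                Function.Surjective h.base) :
    ∀ (k : Type) [Field k] [CharP k p] [PerfectField k] (K : Type) [Field K] [Algebra k K]
      [Algebra.EssFiniteType k K], ∀ M₁ M₂ : ProperModel k K,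
        ∃ (N : ProperModel k K) (φ₁ : N.Hom M₁) (φ₂ : N.Hom M₂),
        (∀ y : N.X, (∃ U : M₁.X.Opens, φ₁.f.base y ∈ U ∧
          ∃ (W : Scheme.{0}) (h : W ⟶ (U : Scheme.{0})), IsIntegral W ∧ Scheme.IsRegular W ∧
            IsFinite h ∧ UniversallyInjective h ∧ Function.Surjective h.base) →
          ∃ V : N.X.Opens, y ∈ V ∧ ∃ (W : Scheme.{0}) (h : W ⟶ (V : Scheme.{0})),
            IsIntegral W ∧ Scheme.IsRegular W ∧ IsFinite h ∧ UniversallyInjective h ∧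
              Function.Surjective h.base) ∧
        (∀ y : N.X, (∃ U : M₂.X.Opens, φ₂.f.base y ∈ U ∧
          ∃ (W : Scheme.{0}) (h : W ⟶ (U : Scheme.{0})), IsIntegral W ∧ Scheme.IsRegular W ∧
            IsFinite h ∧ UniversallyInjective h ∧ Function.Surjective h.base) →
          ∃ V : N.X.Opens, y ∈ V ∧ ∃ (W : Scheme.{0}) (h : W ⟶ (V : Scheme.{0})),
            IsIntegral W ∧ Scheme.IsRegular W ∧ IsFinite h ∧ UniversallyInjective h ∧
              Function.Surjective h.base) := by
  intro k _ _ _ K _ _ _ M₁ M₂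
  exact twoModelTamePatchingAt_of_tame (fun X f hs hl hq hi => h k X f hs hl hq hi) K M₁ M₂

/-! ## Exactness: under `Temkin2013`, the stub is EQUIVALENT to the kernel -/

/-- **Exactness of the cut.** Under the named fact `Temkin2013`, for a prime `p`, tame resolution
over perfect fields of characteristic `p` (the statement of `stub_tameResolution` at `p`) is
EQUIVALENT to two-model tame patching over perfect fields of characteristic `p` (the kernel):
`⇒` is `twoModelTamePatching_of_tame`, `⇐` is
`stub_tameResolution_of_temkin2013_of_twoModelTamePatching`. So the kernel registered as the
residual of the stub is not stronger than the stub. [cite: Piltant2013, Prop. 5.1; Temkin2013, Thm. 1.3.2] -/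
theorem tame_iff_twoModelTamePatching_of_temkin2013 (hT : Temkin2013.{0}) (p : ℕ) (hp : p.Prime) :
    (∀ (k : Type) [Field k] [CharP k p] [PerfectField k] (X : Scheme.{0})
      (f : X ⟶ Spec (.of k)), IsSeparated f → LocallyOfFiniteType f → QuasiCompact f →
        IsIntegral X →
          ∃ (Z : Scheme.{0}) (π : Z ⟶ X), IsProper π ∧ IsBirational π ∧ IsIntegral Z ∧
            (∀ z : Z, IsIntegrallyClosed (Z.presheaf.stalk z)) ∧
            ∀ z : Z, ∃ U : Z.Opens, z ∈ U ∧ ∃ (W : Scheme.{0}) (h : W ⟶ (U : Scheme.{0})),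
              IsIntegral W ∧ Scheme.IsRegular W ∧ IsFinite h ∧ UniversallyInjective h ∧
                Function.Surjective h.base) ↔
    (∀ (k : Type) [Field k] [CharP k p] [PerfectField k] (K : Type) [Field K] [Algebra k K]
      [Algebra.EssFiniteType k K], ∀ M₁ M₂ : ProperModel k K,
        ∃ (N : ProperModel k K) (φ₁ : N.Hom M₁) (φ₂ : N.Hom M₂),
        (∀ y : N.X, (∃ U : M₁.X.Opens, φ₁.f.base y ∈ U ∧
          ∃ (W : Scheme.{0}) (h : W ⟶ (U : Scheme.{0})), IsIntegral W ∧ Scheme.IsRegular W ∧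
            IsFinite h ∧ UniversallyInjective h ∧ Function.Surjective h.base) →
          ∃ V : N.X.Opens, y ∈ V ∧ ∃ (W : Scheme.{0}) (h : W ⟶ (V : Scheme.{0})),
            IsIntegral W ∧ Scheme.IsRegular W ∧ IsFinite h ∧ UniversallyInjective h ∧
              Function.Surjective h.base) ∧
        (∀ y : N.X, (∃ U : M₂.X.Opens, φ₂.f.base y ∈ U ∧
          ∃ (W : Scheme.{0}) (h : W ⟶ (U : Scheme.{0})), IsIntegral W ∧ Scheme.IsRegular W ∧
            IsFinite h ∧ UniversallyInjective h ∧ Function.Surjective h.base) →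
          ∃ V : N.X.Opens, y ∈ V ∧ ∃ (W : Scheme.{0}) (h : W ⟶ (V : Scheme.{0})),
            IsIntegral W ∧ Scheme.IsRegular W ∧ IsFinite h ∧ UniversallyInjective h ∧
              Function.Surjective h.base)) := by
  refine ⟨twoModelTamePatching_of_tame p, fun hZ k _ _ _ X f hs hl hq hi => ?_⟩
  haveI := hs
  haveI := hl
  haveI := hq
  haveI := hi
  exact stub_tameResolution_of_temkin2013_of_twoModelTamePatching hT p hp hZ k X f

/-! ## Resolution in characteristic `p` implies the kernel (K1) -/

/-- **Resolution of singularities in characteristic `p` implies two-model tame patching in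
characteristic `p`** (over perfect fields): a resolution is a tame resolution
(`tameResolution_of_resolutionInChar`), and tame resolution implies the kernel
(`twoModelTamePatching_of_tame`). So the kernel holds wherever resolution is known and is a
consequence of the summit. [cite: Piltant2013, Prop. 5.1] -/
theorem twoModelTamePatching_of_resolutionInChar {p : ℕ} (h : ResolutionInChar.{0} p) :
    ∀ (k : Type) [Field k] [CharP k p] [PerfectField k] (K : Type) [Field K] [Algebra k K]
      [Algebra.EssFiniteType k K], ∀ M₁ M₂ : ProperModel k K,
        ∃ (N : ProperModel k K) (φ₁ : N.Hom M₁) (φ₂ : N.Hom M₂),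
        (∀ y : N.X, (∃ U : M₁.X.Opens, φ₁.f.base y ∈ U ∧
          ∃ (W : Scheme.{0}) (h : W ⟶ (U : Scheme.{0})), IsIntegral W ∧ Scheme.IsRegular W ∧
            IsFinite h ∧ UniversallyInjective h ∧ Function.Surjective h.base) →
          ∃ V : N.X.Opens, y ∈ V ∧ ∃ (W : Scheme.{0}) (h : W ⟶ (V : Scheme.{0})),
            IsIntegral W ∧ Scheme.IsRegular W ∧ IsFinite h ∧ UniversallyInjective h ∧
              Function.Surjective h.base) ∧
        (∀ y : N.X, (∃ U : M₂.X.Opens, φ₂.f.base y ∈ U ∧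
          ∃ (W : Scheme.{0}) (h : W ⟶ (U : Scheme.{0})), IsIntegral W ∧ Scheme.IsRegular W ∧
            IsFinite h ∧ UniversallyInjective h ∧ Function.Surjective h.base) →
          ∃ V : N.X.Opens, y ∈ V ∧ ∃ (W : Scheme.{0}) (h : W ⟶ (V : Scheme.{0})),
            IsIntegral W ∧ Scheme.IsRegular W ∧ IsFinite h ∧ UniversallyInjective h ∧
              Function.Surjective h.base) :=
  twoModelTamePatching_of_tame p fun k _ _ _ X f hs hl hq hi => by
    haveI := hs
    haveI := hl
    haveI := hq
    haveI := hi
    exact tameResolution_of_resolutionInChar h k X f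

/-! ## The field-wise cut (no perfectness) -/

/-- **Tame resolution over a field `k` of characteristic `p` from `Temkin2013` and two-model tame
patching over `k`** — for ANY field `k` (no perfectness): WLOG projective
(`tame_of_forall_normal_isProjectiveOver`, Chow) and the assembly
`tame_of_twoModelTamePatching_of_temkin2013`. [cite: Piltant2013, Prop. 5.1; Temkin2013, Thm. 1.3.2] -/
theorem tame_of_twoModelTamePatchingAt_of_temkin2013 (hT : Temkin2013.{0}) (p : ℕ) [Fact p.Prime]
    {k : Type} [Field k] [CharP k p]
    (hZ : ∀ (K : Type) [Field K] [Algebra k K] [Algebra.EssFiniteType k K],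
      ∀ M₁ M₂ : ProperModel k K, ∃ (N : ProperModel k K) (φ₁ : N.Hom M₁) (φ₂ : N.Hom M₂),
        (∀ y : N.X, (∃ U : M₁.X.Opens, φ₁.f.base y ∈ U ∧
          ∃ (W : Scheme.{0}) (h : W ⟶ (U : Scheme.{0})), IsIntegral W ∧ Scheme.IsRegular W ∧
            IsFinite h ∧ UniversallyInjective h ∧ Function.Surjective h.base) →
          ∃ V : N.X.Opens, y ∈ V ∧ ∃ (W : Scheme.{0}) (h : W ⟶ (V : Scheme.{0})),
            IsIntegral W ∧ Scheme.IsRegular W ∧ IsFinite h ∧ UniversallyInjective h ∧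
              Function.Surjective h.base) ∧
        (∀ y : N.X, (∃ U : M₂.X.Opens, φ₂.f.base y ∈ U ∧
          ∃ (W : Scheme.{0}) (h : W ⟶ (U : Scheme.{0})), IsIntegral W ∧ Scheme.IsRegular W ∧
            IsFinite h ∧ UniversallyInjective h ∧ Function.Surjective h.base) →
          ∃ V : N.X.Opens, y ∈ V ∧ ∃ (W : Scheme.{0}) (h : W ⟶ (V : Scheme.{0})),
            IsIntegral W ∧ Scheme.IsRegular W ∧ IsFinite h ∧ UniversallyInjective h ∧
              Function.Surjective h.base))
    (X : Scheme.{0}) (f : X ⟶ Spec (.of k)) [IsSeparated f] [LocallyOfFiniteType f]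
    [QuasiCompact f] [IsIntegral X] :
    ∃ (Z : Scheme.{0}) (π : Z ⟶ X), IsProper π ∧ IsBirational π ∧ IsIntegral Z ∧
      (∀ z : Z, IsIntegrallyClosed (Z.presheaf.stalk z)) ∧
      ∀ z : Z, ∃ U : Z.Opens, z ∈ U ∧ ∃ (W : Scheme.{0}) (h : W ⟶ (U : Scheme.{0})),
        IsIntegral W ∧ Scheme.IsRegular W ∧ IsFinite h ∧ UniversallyInjective h ∧
          Function.Surjective h.base := by
  refine tame_of_forall_normal_isProjectiveOver f fun X' f' hi' hproj _ => ?_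
  haveI := hi'
  obtain ⟨n, ι, hι⟩ := hproj
  let ι' : X' ⟶ (Motives.projectiveSpace n k).left := ι.left
  haveI : IsClosedImmersion ι' := hι
  exact tame_of_twoModelTamePatching_of_temkin2013 hT p hZ X' ι'

/-- **The cut is exact field-wise, over ANY field of characteristic `p`**: under `Temkin2013`,
every integral separated `k`-scheme of finite type has a tame resolution if and only if
two-model tame patching holds for proper models over `k` (`twoModelTamePatchingAt_of_tame` and
`tame_of_twoModelTamePatchingAt_of_temkin2013`). Perfectness of `k` is not used.
[cite: Piltant2013, Prop. 5.1; Temkin2013, Thm. 1.3.2] -/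
theorem tame_iff_twoModelTamePatchingAt_of_temkin2013 (hT : Temkin2013.{0}) (p : ℕ)
    [Fact p.Prime] (k : Type) [Field k] [CharP k p] :
    (∀ (X : Scheme.{0}) (f : X ⟶ Spec (.of k)), IsSeparated f → LocallyOfFiniteType f →
      QuasiCompact f → IsIntegral X →
        ∃ (Z : Scheme.{0}) (π : Z ⟶ X), IsProper π ∧ IsBirational π ∧ IsIntegral Z ∧
          (∀ z : Z, IsIntegrallyClosed (Z.presheaf.stalk z)) ∧
          ∀ z : Z, ∃ U : Z.Opens, z ∈ U ∧ ∃ (W : Scheme.{0}) (h : W ⟶ (U : Scheme.{0})),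
            IsIntegral W ∧ Scheme.IsRegular W ∧ IsFinite h ∧ UniversallyInjective h ∧
              Function.Surjective h.base) ↔
    (∀ (K : Type) [Field K] [Algebra k K] [Algebra.EssFiniteType k K],
      ∀ M₁ M₂ : ProperModel k K, ∃ (N : ProperModel k K) (φ₁ : N.Hom M₁) (φ₂ : N.Hom M₂),
        (∀ y : N.X, (∃ U : M₁.X.Opens, φ₁.f.base y ∈ U ∧
          ∃ (W : Scheme.{0}) (h : W ⟶ (U : Scheme.{0})), IsIntegral W ∧ Scheme.IsRegular W ∧
            IsFinite h ∧ UniversallyInjective h ∧ Function.Surjective h.base) →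
          ∃ V : N.X.Opens, y ∈ V ∧ ∃ (W : Scheme.{0}) (h : W ⟶ (V : Scheme.{0})),
            IsIntegral W ∧ Scheme.IsRegular W ∧ IsFinite h ∧ UniversallyInjective h ∧
              Function.Surjective h.base) ∧
        (∀ y : N.X, (∃ U : M₂.X.Opens, φ₂.f.base y ∈ U ∧
          ∃ (W : Scheme.{0}) (h : W ⟶ (U : Scheme.{0})), IsIntegral W ∧ Scheme.IsRegular W ∧
            IsFinite h ∧ UniversallyInjective h ∧ Function.Surjective h.base) →
          ∃ V : N.X.Opens, y ∈ V ∧ ∃ (W : Scheme.{0}) (h : W ⟶ (V : Scheme.{0})),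
            IsIntegral W ∧ Scheme.IsRegular W ∧ IsFinite h ∧ UniversallyInjective h ∧
              Function.Surjective h.base)) := by
  refine ⟨fun h K _ _ _ M₁ M₂ => twoModelTamePatchingAt_of_tame h K M₁ M₂,
    fun hZ X f hs hl hq hi => ?_⟩
  haveI := hs
  haveI := hl
  haveI := hq
  haveI := hi
  exact tame_of_twoModelTamePatchingAt_of_temkin2013 hT p hZ X f

/-! ## By name: the stub from its two named residuals, exactness -/

/-- **`stub_tameResolution` from its two named residuals**: the named fact `Temkin2013` (Temkin
2013, Thm. 1.3.2, weak form) and the kernel `TwoModelTamePatching p` (Piltant 2013, Prop. 5.1 with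
`P = P_LRR`, perfect ground fields) imply the registered stub verbatim
(`stub_tameResolution_of_temkin2013_of_twoModelTamePatching`). [cite: Piltant2013, Prop. 5.1; Temkin2013, Thm. 1.3.2] -/
theorem stub_tameResolution_of_temkin2013_of_kernel (hT : Temkin2013.{0}) (p : ℕ) (hp : p.Prime)
    (hZ : TwoModelTamePatching p) (k : Type) [Field k] [CharP k p] [PerfectField k]
    (X : Scheme.{0}) (f : X ⟶ Spec (.of k)) [IsSeparated f] [LocallyOfFiniteType f]
    [QuasiCompact f] [IsIntegral X] :
    ∃ (Z : Scheme.{0}) (π : Z ⟶ X), IsProper π ∧ IsBirational π ∧ IsIntegral Z ∧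
      (∀ z : Z, IsIntegrallyClosed (Z.presheaf.stalk z)) ∧
      ∀ z : Z, ∃ U : Z.Opens, z ∈ U ∧ ∃ (W : Scheme.{0}) (h : W ⟶ (U : Scheme.{0})),
        IsIntegral W ∧ Scheme.IsRegular W ∧ IsFinite h ∧ UniversallyInjective h ∧
          Function.Surjective h.base :=
  stub_tameResolution_of_temkin2013_of_twoModelTamePatching hT p hp hZ k X f

/-- `Temkin2013 ∧ TwoModelTamePatching p ⇒ TameResolutionInChar p` (by name).
[cite: Piltant2013, Prop. 5.1; Temkin2013, Thm. 1.3.2] -/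
theorem tameResolutionInChar_of_temkin2013_of_twoModelTamePatching (hT : Temkin2013.{0}) (p : ℕ)
    (hp : p.Prime) (hZ : TwoModelTamePatching p) : TameResolutionInChar p := by
  intro k _ _ _ X f hs hl hq hi
  haveI := hs
  haveI := hl
  haveI := hq
  haveI := hi
  exact stub_tameResolution_of_temkin2013_of_twoModelTamePatching hT p hp hZ k X f

/-- **The stub implies the kernel** (by name): `TameResolutionInChar p ⇒ TwoModelTamePatching p`
(`twoModelTamePatching_of_tame`: tame-resolve the join of the two models).
[cite: Piltant2013, Prop. 5.1 (proof, Step 2)] -/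
theorem twoModelTamePatching_of_tameResolutionInChar {p : ℕ} (h : TameResolutionInChar p) :
    TwoModelTamePatching p :=
  twoModelTamePatching_of_tame p h

/-- **Exactness by name**: under `Temkin2013`, `TameResolutionInChar p ↔ TwoModelTamePatching p`
for every prime `p`. Registering the kernel as the residual of the stub loses nothing.
[cite: Piltant2013, Prop. 5.1; Temkin2013, Thm. 1.3.2] -/
theorem tameResolutionInChar_iff_twoModelTamePatching (hT : Temkin2013.{0}) (p : ℕ) (hp : p.Prime) :
    TameResolutionInChar p ↔ TwoModelTamePatching p :=
  ⟨twoModelTamePatching_of_tameResolutionInChar,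
    tameResolutionInChar_of_temkin2013_of_twoModelTamePatching hT p hp⟩

/-- **Resolution in characteristic `p` implies the kernel** (by name): through
`tameResolutionInChar_of_resolutionInChar` and `twoModelTamePatching_of_tameResolutionInChar`.
So the kernel is a consequence of the summit and holds wherever resolution does.
[cite: Piltant2013, Prop. 5.1] -/
theorem twoModelTamePatching_of_resolutionInChar' {p : ℕ} (h : ResolutionInChar.{0} p) :
    TwoModelTamePatching p :=
  twoModelTamePatching_of_tameResolutionInChar (tameResolutionInChar_of_resolutionInChar h)

end Summit.ResolutionOfSingularities.ResolutionOfSingularities.Theorems.Pialt.RadiciallyRegular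

end
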